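import Literature.NumberTheory.LFunctions.ZetaLogDerivVKBound
import Literature.NumberTheory.LFunctions.ZetaOneLineBounds
import Mathlib.Analysis.Complex.PhragmenLindelof
import HarnessLib

/-!
# `ζ′/ζ(σ + it) = o(log t)` uniformly on the closed strip `1 ≤ σ ≤ 2`

LABEL (line 1): RH-FREE literature — an unconditional upper bound for the logarithmic derivative of
`ζ` on the closed strip `1 ≤ Re s ≤ 2`; no statement about zeros of `ξ`, no criterion, nothing
RH-equivalent. bears_on: LADDER-RH B-C/B-P (COLUMN 6 DBR: it is the «growth of `ψ(s)` and the
non-vanishing of `ζ(s)` for `Re(s) ≥ 1`» input of [Suzuki2020IntegralOperators] Thm. 1.2 (K-ii), the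
sharp growth `K_θ(x) ≪ e^{x/2}` of Suzuki's single-operator kernel, proved in the sibling module
`SuzukiSingleOperatorKernelGrowthProofs.lean`). WHAT THIS IS NOT: nothing in this file bears on the
truth of RH.

Topic `Literature/NumberTheory/LFunctions`. Everything here is PROVED; no definition, no named fact
is introduced.

## What is proved

* `Literature.NumberTheory.LFunctions.ZetaLogDerivVK.norm_logDeriv_zeta_one_le_eps_mul_log` — the
  tree's Vinogradov–Korobov-strength line bound `ZetaLogDerivVK.norm_logDeriv_zeta_one_le`
  (`|ζ′/ζ(1+it)| ≤ C (log|t|)^{2/3}(log log|t|)^{4/3}`, `|t| ≥ 22`) in the form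
  `∀ ε > 0, ∃ C_ε, |ζ′/ζ(1+it)| ≤ ε log|t| + C_ε` (`|t| ≥ 22`).
* `Literature.NumberTheory.LFunctions.ZetaLogDerivVK.norm_logDeriv_riemannZeta₁_le_of_mem_strip` —
  for every `ε > 0` there is `M` with `|ζ₁′/ζ₁(s)| ≤ ε (log|s + 2| + π) + M` on the whole closed strip
  `1 ≤ Re s ≤ 2` (`ζ₁(s) = (s − 1)ζ(s)`, Mathlib `riemannZeta₁`, pole-free logarithmic derivative).
* `Literature.NumberTheory.LFunctions.ZetaLogDerivVK.norm_logDeriv_zeta_le_of_mem_strip` — for every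
  `ε > 0` there is `C` with `|ζ′/ζ(σ + it)| ≤ ε log|t| + C` for all `1 ≤ σ ≤ 2`, `|t| ≥ 4`.

## The argument (Phragmén–Lindelöf transfer of the line bound)

For `ε > 0` put `W(s) = ε Log(s + 2) + M` (`M ≥ 1` a large constant): `W` is holomorphic and
`Re W(s) = ε log|s + 2| + M ≥ M` on `Re s ≥ 1`. The quotient `f = (ζ₁′/ζ₁)/W` is holomorphic on a
neighbourhood of the closed strip (`ζ₁` is entire and zero-free on `Re s ≥ 1`, Mathlib
`riemannZeta_ne_zero_of_one_le_re`), of polynomial growth in `|t|` inside it (Titchmarsh (3.6.6),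
tree `ZetaOneLine.norm_logDeriv_riemannZeta₁_le`: `≤ 3K log⁹|t|`), bounded by `1` on `Re s = 1`
(`|t| ≥ 22`: the line bound in `ε log|t| + C_ε` form and `log|t| ≤ log|s + 2|`; `|t| ≤ 22`:
compactness) and on `Re s = 2` (`|ζ′/ζ(2 + it)| ≤ Σ Λ(n)n⁻²`). Mathlib's
`PhragmenLindelof.vertical_strip` gives `|f| ≤ 1` on the strip, i.e. `|ζ₁′/ζ₁(s)| ≤ |W(s)|`.

## References

* [Titchmarsh1986] E. C. Titchmarsh, *The Theory of the Riemann Zeta-Function*, 2nd ed. (1986),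
  Theorem 3.11, §3.6 (3.6.6), Theorem 5.17 (5.17.4) (`ζ′/ζ(1+it) = O(log t/log log t)`), §5.1
  (Phragmén–Lindelöf in a strip).
* [Suzuki2020IntegralOperators] M. Suzuki, ASPM 84 (2020) 399–411 = arXiv:1907.07302, §3, proof of
  Thm. 1.2 (K-ii) (the consumer).
-/

noncomputable section

open Complex Filter Topology Set Asymptotics
open scoped Real

namespace Literature.NumberTheory.LFunctions

namespace ZetaLogDerivVK

open VKFromRichert (three_le_log_of_ge)

/-! ## §1 The line bound in the form `ε log|t| + C_ε` -/

/-- **`|ζ′/ζ(1 + it)| ≤ ε log|t| + C_ε` for `|t| ≥ 22`**, for every `ε > 0`: the tree's unconditional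
bound `≪ (log|t|)^{2/3}(log log|t|)^{4/3}` (`norm_logDeriv_zeta_one_le`) and
`(log ℓ)^{4/3} = o(ℓ^{1/3})` (Mathlib `isLittleO_log_rpow_rpow_atTop`).
[cite: Titchmarsh1986, Theorem 5.17 (5.17.4)] -/
theorem norm_logDeriv_zeta_one_le_eps_mul_log {ε : ℝ} (hε : 0 < ε) :
    ∃ C : ℝ, 0 ≤ C ∧ ∀ t : ℝ, 22 ≤ |t| →
      ‖deriv riemannZeta (1 + t * I) / riemannZeta (1 + t * I)‖ ≤ ε * Real.log |t| + C := by
  obtain ⟨C, hC, hb⟩ := norm_logDeriv_zeta_one_le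
  have hεC : 0 < ε / C := div_pos hε hC
  -- `(log ℓ)^{4/3} ≤ (ε/C) ℓ^{1/3}` for `ℓ ≥ L₀`
  obtain ⟨L₀, hL₀⟩ := Filter.eventually_atTop.1
    (((isLittleO_log_rpow_rpow_atTop (4 / 3 : ℝ) (by norm_num : (0 : ℝ) < 1 / 3))).def hεC)
  set L := max L₀ 1 with hLdef
  have hL1 : 1 ≤ L := le_max_right _ _
  have hL0 : 0 < L := by linarith
  -- the constant: the value of the majorant at `ℓ = L`
  have hconst : 0 ≤ C * L ^ (2 / 3 : ℝ) * Real.log L ^ (4 / 3 : ℝ) :=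
    mul_nonneg (mul_nonneg hC.le (Real.rpow_nonneg hL0.le _)) (Real.rpow_nonneg (Real.log_nonneg hL1) _)
  refine ⟨C * L ^ (2 / 3 : ℝ) * Real.log L ^ (4 / 3 : ℝ), hconst, fun t ht => ?_⟩
  have ht0 : 0 < |t| := by linarith
  have hℓ3 : 3 ≤ Real.log |t| := three_le_log_of_ge (by linarith)
  have hℓ0 : 0 < Real.log |t| := by linarith
  have hmain := hb t ht
  set ℓ := Real.log |t| with hℓdef
  rcases le_or_gt L ℓ with hcase | hcase
  · -- large `ℓ`: `C ℓ^{2/3} (log ℓ)^{4/3} ≤ ε ℓ`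
    have h1 := hL₀ ℓ (le_trans (le_max_left _ _) hcase)
    have hlog0 : 0 ≤ Real.log ℓ := Real.log_nonneg (le_trans hL1 hcase)
    rw [Real.norm_of_nonneg (Real.rpow_nonneg hlog0 _),
      Real.norm_of_nonneg (Real.rpow_nonneg hℓ0.le _)] at h1
    have e2 : ℓ ^ (2 / 3 : ℝ) * ℓ ^ (1 / 3 : ℝ) = ℓ := by
      rw [← Real.rpow_add hℓ0]; norm_num
    calc ‖deriv riemannZeta (1 + t * I) / riemannZeta (1 + t * I)‖
        ≤ C * ℓ ^ (2 / 3 : ℝ) * Real.log ℓ ^ (4 / 3 : ℝ) := hmain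
      _ ≤ C * ℓ ^ (2 / 3 : ℝ) * (ε / C * ℓ ^ (1 / 3 : ℝ)) := by gcongr
      _ = ε * (ℓ ^ (2 / 3 : ℝ) * ℓ ^ (1 / 3 : ℝ)) := by field_simp
      _ = ε * ℓ := by rw [e2]
      _ ≤ ε * ℓ + C * L ^ (2 / 3 : ℝ) * Real.log L ^ (4 / 3 : ℝ) := by linarith
  · -- small `ℓ`: monotonicity of the majorant on `[1, L]`
    have hℓL : ℓ ≤ L := hcase.le
    have h1 : ℓ ^ (2 / 3 : ℝ) ≤ L ^ (2 / 3 : ℝ) := Real.rpow_le_rpow hℓ0.le hℓL (by norm_num)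
    have hlogℓ0 : 0 ≤ Real.log ℓ := Real.log_nonneg (by linarith)
    have h2 : Real.log ℓ ^ (4 / 3 : ℝ) ≤ Real.log L ^ (4 / 3 : ℝ) :=
      Real.rpow_le_rpow hlogℓ0 (Real.log_le_log hℓ0 hℓL) (by norm_num)
    calc ‖deriv riemannZeta (1 + t * I) / riemannZeta (1 + t * I)‖
        ≤ C * ℓ ^ (2 / 3 : ℝ) * Real.log ℓ ^ (4 / 3 : ℝ) := hmain
      _ ≤ C * L ^ (2 / 3 : ℝ) * Real.log L ^ (4 / 3 : ℝ) := by gcongr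
      _ ≤ ε * ℓ + C * L ^ (2 / 3 : ℝ) * Real.log L ^ (4 / 3 : ℝ) := by
          have : 0 ≤ ε * ℓ := by positivity
          linarith

/-! ## §2 The weight `W(s) = ε Log(s + 2) + M` -/

/-- `Re W(s) = ε log|s + 2| + M` for the Phragmén–Lindelöf weight `W(s) = ε Log(s + 2) + M`. [folklore] -/
private theorem weight_re (ε M : ℝ) (s : ℂ) :
    ((ε : ℂ) * Complex.log (s + 2) + (M : ℂ)).re = ε * Real.log ‖s + 2‖ + M := by
  simp [Complex.log_re]

/-- For `Re s ≥ 1`: `|s + 2| ≥ 3`. [folklore] -/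
private theorem three_le_norm_add_two {s : ℂ} (hs : 1 ≤ s.re) : 3 ≤ ‖s + 2‖ := by
  have h := Complex.re_le_norm (s + 2)
  have : (s + 2).re = s.re + 2 := by simp
  linarith

/-- `|Im s| ≤ |s + 2|`. [folklore] -/
private theorem abs_im_le_norm_add_two (s : ℂ) : |s.im| ≤ ‖s + 2‖ := by
  have h := Complex.abs_im_le_norm (s + 2)
  simpa using h

/-- For `Re s ≥ 1`, `ε ≥ 0`: `Re W(s) ≥ M`. [folklore] -/
private theorem le_weight_re {ε : ℝ} (M : ℝ) (hε : 0 ≤ ε) {s : ℂ} (hs : 1 ≤ s.re) :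
    M ≤ ((ε : ℂ) * Complex.log (s + 2) + (M : ℂ)).re := by
  rw [weight_re]
  have : 0 ≤ Real.log ‖s + 2‖ := Real.log_nonneg (by linarith [three_le_norm_add_two hs])
  nlinarith

/-- `Re W(s) ≤ ‖W(s)‖`. [folklore] -/
private theorem weight_re_le_norm (ε M : ℝ) (s : ℂ) :
    ((ε : ℂ) * Complex.log (s + 2) + (M : ℂ)).re ≤ ‖(ε : ℂ) * Complex.log (s + 2) + (M : ℂ)‖ :=
  Complex.re_le_norm _

/-- For `Re s ≥ 1`, `ε ≥ 0`, `M > 0`: `W(s) ≠ 0`. [folklore] -/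
private theorem weight_ne_zero {ε M : ℝ} (hε : 0 ≤ ε) (hM : 0 < M) {s : ℂ} (hs : 1 ≤ s.re) :
    (ε : ℂ) * Complex.log (s + 2) + (M : ℂ) ≠ 0 := by
  intro h
  have := le_weight_re M hε hs
  rw [h, Complex.zero_re] at this
  linarith

/-- `‖W(s)‖ ≤ ε (log|s + 2| + π) + M` for `Re s ≥ 1`, `ε, M ≥ 0`. [folklore] -/
private theorem norm_weight_le {ε M : ℝ} (hε : 0 ≤ ε) (hM : 0 ≤ M) {s : ℂ} (hs : 1 ≤ s.re) :
    ‖(ε : ℂ) * Complex.log (s + 2) + (M : ℂ)‖ ≤ ε * (Real.log ‖s + 2‖ + π) + M := by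
  have h3 := three_le_norm_add_two hs
  have hlog0 : 0 ≤ Real.log ‖s + 2‖ := Real.log_nonneg (by linarith)
  have hlog : ‖Complex.log (s + 2)‖ ≤ Real.log ‖s + 2‖ + π := by
    refine (Complex.norm_le_abs_re_add_abs_im _).trans ?_
    rw [Complex.log_re, Complex.log_im, abs_of_nonneg hlog0]
    exact add_le_add le_rfl (Complex.abs_arg_le_pi _)
  calc ‖(ε : ℂ) * Complex.log (s + 2) + (M : ℂ)‖
      ≤ ‖(ε : ℂ) * Complex.log (s + 2)‖ + ‖(M : ℂ)‖ := norm_add_le _ _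
    _ = ε * ‖Complex.log (s + 2)‖ + M := by
        rw [norm_mul, Complex.norm_real, Complex.norm_real, Real.norm_of_nonneg hε,
          Real.norm_of_nonneg hM]
    _ ≤ ε * (Real.log ‖s + 2‖ + π) + M := by gcongr

/-- `W` is complex differentiable at every `s` with `Re s ≥ 1` (`s + 2` lies in the slit plane).
[folklore] -/
private theorem differentiableAt_weight (ε M : ℝ) {s : ℂ} (hs : 1 ≤ s.re) :
    DifferentiableAt ℂ (fun z : ℂ => (ε : ℂ) * Complex.log (z + 2) + (M : ℂ)) s := by
  have hslit : s + 2 ∈ Complex.slitPlane := by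
    rw [Complex.mem_slitPlane_iff]
    left
    simp
    linarith
  exact (((differentiableAt_id.add_const (2 : ℂ)).clog hslit).const_mul _).add_const _

/-! ## §3 The pole-free logarithmic derivative `ζ₁′/ζ₁` on the closed strip -/

/-- `ζ₁′` is entire. [folklore] -/
private theorem differentiable_deriv_riemannZeta₁ : Differentiable ℂ (deriv riemannZeta₁) := fun z =>
  ((differentiable_riemannZeta₁).analyticAt z).deriv.differentiableAt

/-- `ζ₁′/ζ₁` is complex differentiable at every `s` with `Re s ≥ 1` (`ζ₁ ≠ 0` there). [folklore] -/
private theorem differentiableAt_logDeriv_riemannZeta₁ {s : ℂ} (hs : 1 ≤ s.re) :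
    DifferentiableAt ℂ (fun z => deriv riemannZeta₁ z / riemannZeta₁ z) s :=
  (differentiable_deriv_riemannZeta₁ s).div (differentiable_riemannZeta₁ s)
    (ZetaOneLine.riemannZeta₁_ne_zero_of_one_le_re hs)

/-- `ζ₁′/ζ₁ = 1/(s − 1) + ζ′/ζ` for `s ≠ 1` with `ζ(s) ≠ 0`. [folklore] -/
private theorem logDeriv_riemannZeta₁_eq {s : ℂ} (hs1 : s ≠ 1) (hζ : riemannZeta s ≠ 0) :
    deriv riemannZeta₁ s / riemannZeta₁ s = 1 / (s - 1) + deriv riemannZeta s / riemannZeta s := by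
  rw [ZetaOneLine.deriv_riemannZeta₁_eq hs1, LFunctions.riemannZeta₁_eq_mul hs1]
  field_simp [sub_ne_zero.mpr hs1, hζ]

open LSeries in
open scoped LSeries.notation ArithmeticFunction.vonMangoldt in
/-- `|ζ′/ζ(s)| ≤ Σ Λ(n) n⁻²` for `Re s ≥ 2` (termwise). [folklore] -/
private theorem norm_logDeriv_zeta_le_tsum_two {s : ℂ} (hs : 2 ≤ s.re) :
    ‖deriv riemannZeta s / riemannZeta s‖ ≤ ∑' n : ℕ, ‖term ↗Λ (2 : ℂ) n‖ := by
  have hs1 : 1 < s.re := by linarith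
  have hsum0 : Summable fun n ↦ ‖term ↗Λ (2 : ℂ) n‖ := by
    have h := ArithmeticFunction.LSeriesSummable_vonMangoldt (s := (2 : ℂ)) (by simp)
    exact summable_norm_iff.mpr h
  have hle : ∀ n, ‖term ↗Λ s n‖ ≤ ‖term ↗Λ (2 : ℂ) n‖ := fun n ↦
    norm_term_le_of_re_le_re _ (by simpa using hs) n
  have hsum : Summable fun n ↦ ‖term ↗Λ s n‖ :=
    Summable.of_nonneg_of_le (fun _ ↦ norm_nonneg _) hle hsum0
  have heq : deriv riemannZeta s / riemannZeta s = - L ↗Λ s := by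
    rw [ArithmeticFunction.LSeries_vonMangoldt_eq_deriv_riemannZeta_div hs1]; ring
  rw [heq, norm_neg]
  calc ‖L ↗Λ s‖ = ‖∑' n, term ↗Λ s n‖ := rfl
    _ ≤ ∑' n, ‖term ↗Λ s n‖ := norm_tsum_le_tsum_norm hsum
    _ ≤ ∑' n, ‖term ↗Λ (2 : ℂ) n‖ := hsum.tsum_le_tsum hle hsum0

/-- A bound for `ζ₁′/ζ₁` on the compact segment `{1 + it : |t| ≤ 22}` (continuity). [folklore] -/
private theorem exists_bound_logDeriv_riemannZeta₁_segment :
    ∃ M₀ : ℝ, 0 ≤ M₀ ∧ ∀ z : ℂ, z.re = 1 → |z.im| ≤ 22 →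
      ‖deriv riemannZeta₁ z / riemannZeta₁ z‖ ≤ M₀ := by
  set S : Set ℂ := (fun t : ℝ => (1 : ℂ) + t * I) '' Icc (-22 : ℝ) 22 with hSdef
  have hS : IsCompact S := (isCompact_Icc.image (by fun_prop))
  have hcont : ContinuousOn (fun z => deriv riemannZeta₁ z / riemannZeta₁ z) S := by
    refine fun z hz => (differentiableAt_logDeriv_riemannZeta₁ ?_).continuousAt.continuousWithinAt
    obtain ⟨t, _, rfl⟩ := hz
    simp
  obtain ⟨M₀, hM₀⟩ := hS.exists_bound_of_continuousOn hcont
  refine ⟨max M₀ 0, le_max_right _ _, fun z hzre hzim => ?_⟩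
  have hz : z ∈ S := by
    refine ⟨z.im, abs_le.1 hzim, ?_⟩
    apply Complex.ext <;> simp [hzre]
  exact (hM₀ z hz).trans (le_max_left _ _)

/-! ## §4 Phragmén–Lindelöf on the strip `1 ≤ Re s ≤ 2` -/

open LSeries in
open scoped LSeries.notation ArithmeticFunction.vonMangoldt in
/-- **`ζ₁′/ζ₁(s) = o(log t)` uniformly on the closed strip `1 ≤ Re s ≤ 2`:** for every `ε > 0`
there is `M ≥ 0` with `‖ζ₁′(s)/ζ₁(s)‖ ≤ ε (log|s + 2| + π) + M` whenever `1 ≤ Re s ≤ 2`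
(`ζ₁(s) = (s − 1)ζ(s)`). Phragmén–Lindelöf in the strip applied to `(ζ₁′/ζ₁)/(ε Log(s+2) + M)`, fed
by the line bound of §1, the trivial bound on `Re s = 2`, compactness near `t = 0`, and Titchmarsh's
(3.6.6) as the a-priori interior growth. [cite: Titchmarsh1986, Theorem 5.17 (5.17.4) and §5.1] -/
theorem norm_logDeriv_riemannZeta₁_le_of_mem_strip {ε : ℝ} (hε : 0 < ε) :
    ∃ M : ℝ, 0 ≤ M ∧ ∀ s : ℂ, 1 ≤ s.re → s.re ≤ 2 →
      ‖deriv riemannZeta₁ s / riemannZeta₁ s‖ ≤ ε * (Real.log ‖s + 2‖ + π) + M := by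
  obtain ⟨C₁, hC₁, hline⟩ := norm_logDeriv_zeta_one_le_eps_mul_log hε
  obtain ⟨M₀, hM₀, hseg⟩ := exists_bound_logDeriv_riemannZeta₁_segment
  set A₂ : ℝ := ∑' n : ℕ, ‖term ↗Λ (2 : ℂ) n‖ with hA₂
  have hA₂0 : 0 ≤ A₂ := tsum_nonneg fun _ => norm_nonneg _
  set M : ℝ := 2 + C₁ + M₀ + A₂ with hMdef
  have hM1 : 1 ≤ M := by rw [hMdef]; linarith
  have hM0 : 0 < M := by linarith
  refine ⟨M, hM0.le, fun s hs1 hs2 => ?_⟩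
  -- the functions
  set G : ℂ → ℂ := fun z => deriv riemannZeta₁ z / riemannZeta₁ z with hGdef
  set W : ℂ → ℂ := fun z => (ε : ℂ) * Complex.log (z + 2) + (M : ℂ) with hWdef
  set f : ℂ → ℂ := fun z => G z / W z with hfdef
  set K : ℝ := 1134 * 16 * 336 ^ 4 with hKdef
  -- (a) differentiability on `Re z ≥ 1`
  have hWne : ∀ z : ℂ, 1 ≤ z.re → W z ≠ 0 := fun z hz => weight_ne_zero hε.le hM0 hz
  have hWre : ∀ z : ℂ, 1 ≤ z.re → M ≤ (W z).re := fun z hz => le_weight_re M hε.le hz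
  have hWre_le : ∀ z : ℂ, (W z).re ≤ ‖W z‖ := fun z => weight_re_le_norm ε M z
  have hWre_eq : ∀ z : ℂ, (W z).re = ε * Real.log ‖z + 2‖ + M := fun z => weight_re ε M z
  have hdiff : ∀ z : ℂ, 1 ≤ z.re → DifferentiableAt ℂ f z := fun z hz =>
    (differentiableAt_logDeriv_riemannZeta₁ hz).div (differentiableAt_weight ε M hz) (hWne z hz)
  have hfd : DiffContOnCl ℂ f (re ⁻¹' Ioo (1 : ℝ) 2) := by
    apply DifferentiableOn.diffContOnCl
    rw [closure_preimage_re, closure_Ioo (by norm_num : (1 : ℝ) ≠ 2)]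
    exact fun z hz => (hdiff z hz.1).differentiableWithinAt
  -- (b) `‖f z‖ ≤ 1` from `‖G z‖ ≤ Re W z`
  have hfle : ∀ z : ℂ, 1 ≤ z.re → ‖G z‖ ≤ (W z).re → ‖f z‖ ≤ 1 := by
    intro z hz hGz
    have hW := hWne z hz
    rw [hfdef]
    simp only
    rw [norm_div, div_le_one (norm_pos_iff.2 hW)]
    exact hGz.trans (hWre_le z)
  -- (c) boundary `Re z = 1`
  have hle_a : ∀ z : ℂ, z.re = 1 → ‖f z‖ ≤ 1 := by
    intro z hz
    refine hfle z hz.ge ?_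
    rw [hWre_eq]
    have hlog0 : 0 ≤ Real.log ‖z + 2‖ := Real.log_nonneg (by linarith [three_le_norm_add_two hz.ge])
    rcases le_or_gt 22 |z.im| with ht | ht
    · -- `|t| ≥ 22`: the line bound
      have hz1 : z ≠ 1 := by
        intro h; rw [h] at ht; norm_num at ht
      have hzeq : z = 1 + z.im * I := by
        apply Complex.ext <;> simp [hz]
      have hζ : riemannZeta z ≠ 0 := riemannZeta_ne_zero_of_one_le_re hz.ge
      have h1 : ‖(1 : ℂ) / (z - 1)‖ ≤ 1 := by
        rw [norm_div, norm_one]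
        have him : |z.im| ≤ ‖z - 1‖ := by
          have := Complex.abs_im_le_norm (z - 1); simpa using this
        rw [div_le_one (lt_of_lt_of_le (by linarith) him)]
        linarith
      have h2 : ‖deriv riemannZeta z / riemannZeta z‖ ≤ ε * Real.log |z.im| + C₁ := by
        have := hline z.im ht
        rwa [← hzeq] at this
      have h3 : Real.log |z.im| ≤ Real.log ‖z + 2‖ :=
        Real.log_le_log (by linarith) (abs_im_le_norm_add_two z)
      calc ‖G z‖ = ‖1 / (z - 1) + deriv riemannZeta z / riemannZeta z‖ := by
            rw [hGdef]; simp only; rw [logDeriv_riemannZeta₁_eq hz1 hζ]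
        _ ≤ ‖(1 : ℂ) / (z - 1)‖ + ‖deriv riemannZeta z / riemannZeta z‖ := norm_add_le _ _
        _ ≤ 1 + (ε * Real.log |z.im| + C₁) := add_le_add h1 h2
        _ ≤ 1 + (ε * Real.log ‖z + 2‖ + C₁) := by gcongr
        _ ≤ ε * Real.log ‖z + 2‖ + M := by rw [hMdef]; linarith
    · -- `|t| < 22`: compactness
      have h1 : ‖G z‖ ≤ M₀ := hseg z hz ht.le
      calc ‖G z‖ ≤ M₀ := h1
        _ ≤ ε * Real.log ‖z + 2‖ + M := by rw [hMdef]; nlinarith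
  -- (d) boundary `Re z = 2`
  have hle_b : ∀ z : ℂ, z.re = 2 → ‖f z‖ ≤ 1 := by
    intro z hz
    refine hfle z (by rw [hz]; norm_num) ?_
    rw [hWre_eq]
    have hlog0 : 0 ≤ Real.log ‖z + 2‖ :=
      Real.log_nonneg (by linarith [three_le_norm_add_two (s := z) (by rw [hz]; norm_num)])
    have hz1 : z ≠ 1 := by
      intro h; rw [h] at hz; norm_num at hz
    have hζ : riemannZeta z ≠ 0 := riemannZeta_ne_zero_of_one_le_re (by rw [hz]; norm_num)
    have h1 : ‖(1 : ℂ) / (z - 1)‖ ≤ 1 := by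
      rw [norm_div, norm_one]
      have hre : (1 : ℝ) ≤ ‖z - 1‖ := by
        have := Complex.re_le_norm (z - 1)
        have h' : (z - 1).re = 1 := by simp [hz]; norm_num
        linarith
      rw [div_le_one (by linarith)]
      exact hre
    have h2 : ‖deriv riemannZeta z / riemannZeta z‖ ≤ A₂ :=
      norm_logDeriv_zeta_le_tsum_two (by rw [hz])
    calc ‖G z‖ = ‖1 / (z - 1) + deriv riemannZeta z / riemannZeta z‖ := by
          rw [hGdef]; simp only; rw [logDeriv_riemannZeta₁_eq hz1 hζ]
      _ ≤ ‖(1 : ℂ) / (z - 1)‖ + ‖deriv riemannZeta z / riemannZeta z‖ := norm_add_le _ _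
      _ ≤ 1 + A₂ := add_le_add h1 h2
      _ ≤ ε * Real.log ‖z + 2‖ + M := by rw [hMdef]; nlinarith
  -- (e) a-priori growth inside the strip: `‖f‖ ≤ 3K log⁹|t| ≤ 3K exp(9 exp|t|)` for `|t| ≥ 4`
  have hB : ∃ c < π / ((2 : ℝ) - 1), ∃ B : ℝ,
      f =O[comap (_root_.abs ∘ im) atTop ⊓ 𝓟 (re ⁻¹' Ioo (1 : ℝ) 2)]
        fun z ↦ Real.exp (B * Real.exp (c * |z.im|)) := by
    refine ⟨1, by rw [show (2 : ℝ) - 1 = 1 by norm_num, div_one]; linarith [Real.pi_gt_three],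
      9, ?_⟩
    refine IsBigO.of_bound (3 * K) ?_
    have h1 : ∀ᶠ z : ℂ in comap (_root_.abs ∘ im) atTop, 4 ≤ |z.im| :=
      (eventually_ge_atTop (4 : ℝ)).comap (_root_.abs ∘ im)
    have h2 : ∀ᶠ z : ℂ in 𝓟 (re ⁻¹' Ioo (1 : ℝ) 2), z ∈ re ⁻¹' Ioo (1 : ℝ) 2 :=
      eventually_principal.2 fun z hz => hz
    filter_upwards [h1.filter_mono inf_le_left, h2.filter_mono inf_le_right] with z hz4 hz
    have hz' : 1 < z.re ∧ z.re < 2 := hz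
    have hK1 : (1 : ℝ) ≤ K := by rw [hKdef]; norm_num
    have hlog1 : 1 ≤ Real.log |z.im| := by
      have : Real.log 4 ≥ 1 := by
        have h4 : Real.exp 1 ≤ 4 := by
          have := Real.exp_one_lt_d9; linarith
        calc (1 : ℝ) = Real.log (Real.exp 1) := (Real.log_exp 1).symm
          _ ≤ Real.log 4 := Real.log_le_log (Real.exp_pos 1) h4
      exact this.le.trans (Real.log_le_log (by norm_num) hz4)
    have hσ : 1 - 1 / (2 * (1134 * 16 * 336 ^ 4) * Real.log |z.im| ^ 9) ≤ z.re := by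
      have : 0 ≤ 1 / (2 * (1134 * 16 * 336 ^ 4) * Real.log |z.im| ^ 9) := by positivity
      linarith [hz'.1]
    have hG : ‖G z‖ ≤ 3 * K * Real.log |z.im| ^ 9 := by
      have := ZetaOneLine.norm_logDeriv_riemannZeta₁_le hz4 hσ hz'.2.le
      rw [hGdef, hKdef]; exact this
    have hW1 : 1 ≤ ‖W z‖ := hM1.trans ((hWre z hz'.1.le).trans (hWre_le z))
    -- `log|t| ≤ |t| ≤ exp|t|`, so `log⁹|t| ≤ exp(9|t|) ≤ exp(9 exp|t|)`
    have hlt : Real.log |z.im| ≤ Real.exp |z.im| :=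
      (Real.log_le_sub_one_of_pos (by linarith)).trans
        (by linarith [Real.add_one_le_exp |z.im|])
    have hpow : Real.log |z.im| ^ 9 ≤ Real.exp (9 * Real.exp (1 * |z.im|)) := by
      rw [one_mul]
      calc Real.log |z.im| ^ 9 ≤ Real.exp |z.im| ^ 9 :=
            pow_le_pow_left₀ (by linarith) hlt 9
        _ = Real.exp (9 * |z.im|) := by rw [← Real.exp_nat_mul]; norm_num
        _ ≤ Real.exp (9 * Real.exp |z.im|) :=
            Real.exp_le_exp.2 (by nlinarith [Real.add_one_le_exp |z.im|, abs_nonneg z.im])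
    rw [Real.norm_of_nonneg (Real.exp_pos _).le]
    calc ‖f z‖ = ‖G z‖ / ‖W z‖ := by rw [hfdef]; simp only; rw [norm_div]
      _ ≤ ‖G z‖ := div_le_self (norm_nonneg _) hW1
      _ ≤ 3 * K * Real.log |z.im| ^ 9 := hG
      _ ≤ 3 * K * Real.exp (9 * Real.exp (1 * |z.im|)) := by gcongr
  -- (f) Phragmén–Lindelöf
  have hPL := PhragmenLindelof.vertical_strip hfd hB hle_a hle_b (z := s) hs1 hs2
  -- unwind: `‖G s‖ ≤ ‖W s‖ ≤ ε (log|s+2| + π) + M`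
  have hW := hWne s hs1
  have hGs : ‖G s‖ ≤ ‖W s‖ := by
    have : G s = f s * W s := by
      rw [hfdef]; simp only; rw [div_mul_cancel₀ _ hW]
    rw [this, norm_mul]
    calc ‖f s‖ * ‖W s‖ ≤ 1 * ‖W s‖ := by gcongr
      _ = ‖W s‖ := one_mul _
  exact hGs.trans (norm_weight_le hε.le hM0.le hs1)

/-- **`ζ′/ζ(σ + it) = o(log t)` uniformly for `1 ≤ σ ≤ 2`:** for every `ε > 0` there is `C` with
`‖ζ′(s)/ζ(s)‖ ≤ ε log|t| + C` for all `s = σ + it` with `1 ≤ σ ≤ 2` and `|t| ≥ 4`. (On the line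
`σ = 1` this is Titchmarsh's (5.17.4) `ζ′/ζ(1+it) = O(log t/log log t)` in weakened form; the
uniformity in `σ` is by Phragmén–Lindelöf.) [cite: Titchmarsh1986, Theorem 5.17 (5.17.4) and §5.1] -/
theorem norm_logDeriv_zeta_le_of_mem_strip {ε : ℝ} (hε : 0 < ε) :
    ∃ C : ℝ, 0 ≤ C ∧ ∀ s : ℂ, 1 ≤ s.re → s.re ≤ 2 → 4 ≤ |s.im| →
      ‖deriv riemannZeta s / riemannZeta s‖ ≤ ε * Real.log |s.im| + C := by
  obtain ⟨M, hM, hstrip⟩ := norm_logDeriv_riemannZeta₁_le_of_mem_strip hε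
  refine ⟨ε * (1 + π) + M + 1, by positivity, fun s hs1 hs2 ht => ?_⟩
  have ht0 : 0 < |s.im| := by linarith
  have hs_ne : s ≠ 1 := by
    intro h; rw [h] at ht; norm_num at ht
  have hζ : riemannZeta s ≠ 0 := riemannZeta_ne_zero_of_one_le_re hs1
  have h1 := hstrip s hs1 hs2
  rw [logDeriv_riemannZeta₁_eq hs_ne hζ] at h1
  -- `‖1/(s-1)‖ ≤ 1/|t| ≤ 1`
  have h2 : ‖(1 : ℂ) / (s - 1)‖ ≤ 1 := by
    rw [norm_div, norm_one]
    have him : |s.im| ≤ ‖s - 1‖ := by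
      have := Complex.abs_im_le_norm (s - 1); simpa using this
    rw [div_le_one (lt_of_lt_of_le ht0 him)]
    linarith
  -- `log|s + 2| ≤ log(2|t|) ≤ 1 + log|t|`
  have h3 : Real.log ‖s + 2‖ ≤ 1 + Real.log |s.im| := by
    have hn : ‖s + 2‖ ≤ 2 * |s.im| := by
      have := Complex.norm_le_abs_re_add_abs_im (s + 2)
      have hre : |(s + 2).re| ≤ 4 := by
        rw [abs_le]; simp; constructor <;> linarith
      have him : (s + 2).im = s.im := by simp
      rw [him] at this
      linarith
    calc Real.log ‖s + 2‖ ≤ Real.log (2 * |s.im|) :=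
          Real.log_le_log (by linarith [three_le_norm_add_two hs1]) hn
      _ = Real.log 2 + Real.log |s.im| := Real.log_mul (by norm_num) ht0.ne'
      _ ≤ 1 + Real.log |s.im| := by linarith [Real.log_two_lt_d9]
  have h4 : ‖deriv riemannZeta s / riemannZeta s‖ ≤
      ‖(1 : ℂ) / (s - 1)‖ + ‖1 / (s - 1) + deriv riemannZeta s / riemannZeta s‖ := by
    have := norm_sub_le ((1 : ℂ) / (s - 1) + deriv riemannZeta s / riemannZeta s) (1 / (s - 1))
    rw [add_sub_cancel_left] at this
    linarith
  calc ‖deriv riemannZeta s / riemannZeta s‖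
      ≤ 1 + (ε * (Real.log ‖s + 2‖ + π) + M) := by linarith
    _ ≤ 1 + (ε * (1 + Real.log |s.im| + π) + M) := by gcongr
    _ = ε * Real.log |s.im| + (ε * (1 + π) + M + 1) := by ring

end ZetaLogDerivVK

end Literature.NumberTheory.LFunctions

end
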